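import Summits.CriticalPhenomena.SAWScalingLimit.Theorems.SAWLoopFugacityFlowIsingBoundaryRatioWindowRectCut
import Summits.CriticalPhenomena.SAWScalingLimit.Theorems.SAWLoopFugacityFlowIsingBoundaryRatioWindowRectBulk
import Literature.Probability.LatticeModels.MeshDomainJordan
import HarnessLib

/-!
# The lattice window admits a rectangle presentation
(line `fk-anchor-transfer`, crux `IsingBoundaryRatio`, stmt-CriticalPhenomena-10650: the registered stub
`windowRectPresentation_holds : WindowRectPresentation` of `…IsingBoundaryRatioWindowRectDefs.lean`)

Assembly of the static setting `WSetting` (`…WindowRectSetting`) from the data of `WindowRectPresentation`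
for all small mesh `δ` — chart package (`…WindowRectChart`), distance from `b` (boundary value of `φ` at `∞`),
compact bulk region and its lattice step constants (`…WindowRectBulk`), chart oscillation `κ` (uniform
continuity of the extended inverse chart away from `b`), angular margin `θ₀` and route separation `η`
(`…WindowRectRoutesSep`), shadowing of chart paths (`…WindowRectShadow`), the base site next to `φ(i r⋆)` —
followed by the rectangle presentation of the window edge set in the setting
(`…WindowRectCut.exists_isWindowRect`). [folklore]
-/

noncomputable section

open scoped Classical Topology Real
open Filter Set Metric Complex
open Literature.Probability.LatticeModels Literature.Probability.RandomPlanarGeometry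
open Literature.Probability.LatticeModels.DiscreteRect Literature.Topology.PlaneTopology
open UpperHalfPlane (upperHalfPlaneSet)

namespace Summit.CriticalPhenomena.SAWScalingLimit.Theorems.IsingBoundaryRatio

namespace WindowRect

/-- The compact bulk region of the chart. [folklore] -/
theorem isCompact_bulkRegion (a b h : ℝ) :
    IsCompact {w : ℂ | a ≤ ‖w‖ ∧ ‖w‖ ≤ b ∧ h ≤ w.im} := by
  refine Metric.isCompact_of_isClosed_isBounded ?_ ?_
  · refine (isClosed_le continuous_const continuous_norm).inter
      ((isClosed_le continuous_norm continuous_const).inter (isClosed_le continuous_const Complex.continuous_im))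
  · exact (isBounded_closedBall (x := (0 : ℂ)) (r := b)).subset fun w hw => by
      rw [mem_closedBall, dist_zero_right]; exact hw.2.1

/-- **The angular margin**: for `θ₀ = min (m/(1+U²)) (2(π - 2 arctan U)) ⊓ π`, parameters of absolute value
`≤ U` at distance `≥ m/2` have boundary angles `θ₀`-apart modulo `2π`. [folklore] -/
theorem angular_margin {m U : ℝ} (hm : 0 < m) :
    let θ₀ := min (min (m / (1 + U ^ 2)) (2 * (π - 2 * Real.arctan U))) π
    0 < θ₀ ∧ θ₀ ≤ π ∧ ∀ u v : ℝ, |u| ≤ U → |v| ≤ U → m / 2 ≤ |u - v| →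
      θ₀ ≤ |(π + 2 * Real.arctan u) - (π + 2 * Real.arctan v)| ∧
        |(π + 2 * Real.arctan u) - (π + 2 * Real.arctan v)| ≤ 2 * π - θ₀ := by
  intro θ₀
  have hU : (0 : ℝ) < 1 + U ^ 2 := by positivity
  have hmar := angleMargin_pos U
  refine ⟨lt_min (lt_min (div_pos hm hU) (by linarith)) Real.pi_pos, min_le_right _ _, fun u v hu hv huv => ⟨?_, ?_⟩⟩
  · have h1 := abs_angle_sub_angle_ge hu hv
    have h2 : m / (1 + U ^ 2) ≤ 2 * |u - v| / (1 + U ^ 2) := div_le_div_of_nonneg_right (by linarith) hU.le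
    exact ((min_le_left _ _).trans (min_le_left _ _)).trans (h2.trans h1)
  · have h1 := abs_angle_sub_angle_le hu hv
    have h2 : θ₀ ≤ 2 * (π - 2 * Real.arctan U) := (min_le_left _ _).trans (min_le_right _ _)
    linarith

end WindowRect

open WindowRect in
set_option maxHeartbeats 1600000 in
/-- **The lattice window admits a rectangle presentation** (the registered stub). [folklore] -/
theorem windowRectPresentation_holds : WindowRectPresentation := by
  intro D φ hφ M hM ε hε
  have hM0 : 0 < M := one_pos.trans hM
  obtain ⟨rb, hrb, hballr⟩ := Metric.tendsto_nhdsWithin_nhds.1 hφ.1 ε hε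
  refine ⟨rb / M, div_pos hrb hM0, fun ρ hρ hρr r₁ r₁' r₂' r₂ hρr₁ hr₁₁ hr₁₂ hr₂₂ hr₂ => ?_⟩
  have hMr : M * ρ < rb := by rwa [lt_div_iff₀ hM0, mul_comm] at hρr
  have hinball : ∀ z ∈ D.carrier, ‖φ.symm z‖ < M * ρ → z ∈ ball (D.pt 0) ε := by
    intro z hz hzr
    have h := hballr (φ.symm_mapsTo hz) (by rw [dist_zero_right]; exact hzr.trans hMr)
    rwa [φ.apply_symm_apply hz] at h
  -- the margin `m`
  set m : ℝ := min (r₁' - r₁) (r₂ - r₂') / 10 with hm_def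
  have hm : 0 < m := by rw [hm_def]; exact div_pos (lt_min (by linarith) (by linarith)) (by norm_num)
  have hr₁m : r₁ + 8 * m ≤ r₁' := by
    have := min_le_left (r₁' - r₁) (r₂ - r₂'); rw [hm_def]; linarith
  have hr₂m : r₂' + 8 * m ≤ r₂ := by
    have := min_le_right (r₁' - r₁) (r₂ - r₂'); rw [hm_def]; linarith
  have hr₁0 : 0 < r₁ := hρ.trans hρr₁
  -- the chart package
  obtain ⟨g, H, hgc, hgeq, hgreal, hginj, hg0, hH, -, hHfr, -⟩ := exists_chart_package hφ
  -- far from `b`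
  obtain ⟨d, hd, hdball⟩ := Metric.mem_nhdsWithin_iff.1
    (hφ.tendsto_symm_cocompact ((isCompact_closedBall (0 : ℂ) (r₂ + m)).compl_mem_cocompact))
  have hfar : ∀ z ∈ D.carrier, ‖φ.symm z‖ ≤ r₂ + m → d ≤ dist z (D.pt 1) := by
    intro z hz hzr
    by_contra h
    push Not at h
    have := hdball ⟨Metric.mem_ball.2 h, hz⟩
    simp only [mem_preimage, mem_compl_iff, mem_closedBall, dist_zero_right, not_le] at this
    linarith
  -- the compact bulk region and the lattice step constants
  set K : Set ℂ := {w : ℂ | r₁ + m ≤ ‖w‖ ∧ ‖w‖ ≤ r₂ - m ∧ (r₁ + 4 * m) / 20 ≤ w.im} with hK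
  have hKc : IsCompact K := isCompact_bulkRegion _ _ _
  have hKH : K ⊆ upperHalfPlaneSet := fun w hw => show 0 < w.im by linarith [hw.2.2]
  obtain ⟨c, C, hc, hcC, hstepE⟩ := exists_bulk_step D.toJordanDomain φ hKc hKH
  have hC : 0 < C := hc.trans_le hcC
  -- the oscillation `κ`
  set κ : ℝ := min (m / 100) (c * m / (100 * C)) with hκ_def
  have hκ : 0 < κ := lt_min (by positivity) (by positivity)
  have hκm : 100 * κ ≤ m := by have := min_le_left (m / 100) (c * m / (100 * C)); rw [hκ_def]; linarith
  have hκstep : 100 * κ * C ≤ c * m := by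
    have h1 : κ ≤ c * m / (100 * C) := min_le_right _ _
    rw [le_div_iff₀ (by positivity)] at h1; linarith
  -- uniform continuity of `g` away from `b`
  set Bs : Set ℂ := closure D.carrier ∩ (ball (D.pt 1) (d / 4))ᶜ with hBs
  have hBsc : IsCompact Bs := D.isBounded.isCompact_closure.inter_right isOpen_ball.isClosed_compl
  have hBsub : Bs ⊆ closure D.carrier \ {D.pt 1} := by
    rintro z ⟨hz, hzb⟩
    refine ⟨hz, fun h => hzb ?_⟩
    rw [mem_singleton_iff] at h
    rw [h]; exact mem_ball_self (by positivity)
  obtain ⟨τ, hτ, hτg⟩ := Metric.uniformContinuousOn_iff.1 (hBsc.uniformContinuousOn_of_continuous (hgc.mono hBsub)) κ hκ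
  have hmemBs : ∀ z ∈ closure D.carrier, d / 4 ≤ dist z (D.pt 1) → z ∈ Bs := fun z hz hzd =>
    ⟨hz, fun h => by rw [mem_ball] at h; linarith⟩
  -- the angular margin and the route separation
  obtain ⟨hθ₀, hθ₀π, hθ₀sep⟩ := angular_margin (U := r₂ + m) hm
  set θ₀ := min (min (m / (1 + (r₂ + m) ^ 2)) (2 * (π - 2 * Real.arctan (r₂ + m)))) π with hθ₀_def
  obtain ⟨η, hη, hsep⟩ := exists_sep_routes D.toJordanDomain H hH hθ₀ hθ₀π
  -- shadowing
  have hsh := eventually_shadow D.toJordanDomain φ hKc hKH hκ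
  -- the base point
  set wtop : ℂ := (((r₁' + r₂') / 2 : ℝ) : ℂ) * I with hwtop
  have hwtopH : wtop ∈ upperHalfPlaneSet := by show 0 < wtop.im; simp [hwtop]; linarith
  have hwtopn : ‖wtop‖ = (r₁' + r₂') / 2 := by
    rw [hwtop, norm_mul, norm_I, mul_one, norm_real, Real.norm_eq_abs, abs_of_pos (by linarith)]
  have hztopD : φ wtop ∈ D.carrier := φ.mapsTo hwtopH
  obtain ⟨sD, hsD, hsDball⟩ := Metric.isOpen_iff.1 D.isOpen (φ wtop) hztopD
  have hKD : closedBall (φ wtop) (sD / 2) ⊆ D.carrier := (closedBall_subset_ball (half_lt_self hsD)).trans hsDball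
  have hmesh := JordanDomain.eventually_forall_mem_meshDomain' D.toJordanDomain (isCompact_closedBall (φ wtop) (sD / 2)) hKD
  -- the threshold
  have hδ₀ : 0 < min (min (τ / 4) (d / 8)) (min (min (η / 4) (κ / C)) (sD / 4)) := by positivity
  filter_upwards [Ioo_mem_nhdsGT hδ₀, hsh, hstepE, hmesh] with δ hδ hshδ hstepδ hmeshδ
  obtain ⟨hδ0, hδlt⟩ := hδ
  have hδτ : 4 * δ < τ := by linarith [(lt_min_iff.1 (lt_min_iff.1 hδlt).1).1]
  have hδd : 8 * δ ≤ d := by linarith [(lt_min_iff.1 (lt_min_iff.1 hδlt).1).2]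
  have hδη : 2 * δ < η := by linarith [(lt_min_iff.1 (lt_min_iff.1 (lt_min_iff.1 hδlt).2).1).1]
  have hδC : C * δ ≤ κ := by
    have h1 : δ < κ / C := (lt_min_iff.1 (lt_min_iff.1 (lt_min_iff.1 hδlt).2).1).2
    rw [lt_div_iff₀ hC] at h1; linarith
  have hδs : δ ≤ sD / 4 := by linarith [(lt_min_iff.1 (lt_min_iff.1 hδlt).2).2]
  intro Λ _ hΛ
  -- the oscillation over `2δ`
  have hmod : ∀ z ∈ closure D.carrier, ∀ z' ∈ closure D.carrier, d / 2 ≤ dist z (D.pt 1) → dist z z' ≤ 2 * δ →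
      dist (g z) (g z') ≤ κ := by
    intro z hz z' hz' hzd hzz'
    have hzB := hmemBs z hz (by linarith)
    have hz'B := hmemBs z' hz' (by linarith [dist_triangle z z' (D.pt 1)])
    exact (hτg z hzB z' hz'B (by linarith)).le
  -- the base site
  set z₀ : Site 2 := nearestSite δ (φ wtop) with hz₀
  have hz₀d : dist (meshPoint δ z₀) (φ wtop) ≤ δ := dist_meshPoint_nearestSite_le hδ0 _
  have hz₀K : meshPoint δ z₀ ∈ closedBall (φ wtop) (sD / 2) := mem_closedBall.2 (by linarith)
  have hz₀D : meshPoint δ z₀ ∈ D.carrier := hKD hz₀K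
  have hz₀mesh : z₀ ∈ meshDomain D.carrier δ := hmeshδ.1 z₀ hz₀K
  have hz₀c : dist (φ.symm (meshPoint δ z₀)) wtop ≤ κ := by
    have h1 := hmod (φ wtop) (subset_closure hztopD) (meshPoint δ z₀) (subset_closure hz₀D)
      (by linarith [hfar _ hztopD (by rw [φ.symm_apply_apply hwtopH, hwtopn]; linarith)])
      (by rw [dist_comm]; linarith)
    rwa [hgeq hztopD, hgeq hz₀D, φ.symm_apply_apply hwtopH, dist_comm] at h1
  -- the setting
  let X : WindowRect.WSetting :=
    { D := D, φ := φ, M := M, ε := ε, ρ := ρ, r₁ := r₁, r₁' := r₁', r₂' := r₂', r₂ := r₂, m := m, δ := δ, κ := κ,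
      Λ := Λ, g := g, H := H, d := d, z₀ := z₀, cstar := c, Cstar := C, θ₀ := θ₀, η := η,
      hρ := hρ, hρr₁ := hρr₁, hr₂ := hr₂, hm := hm, hr₁ := hr₁m, hr₁₂ := hr₁₂, hr₂' := hr₂m, hδ := hδ0, hκ := hκ,
      hκm := hκm, hg_cont := hgc, hg_eq := hgeq, hg_real := hgreal, hg_inj := hginj, hg_zero := hg0, hH := hH,
      hH_fr := hHfr, hd := hd, hfar := hfar, hδd := hδd, hmod := hmod, hball := hinball, hΛ := hΛ, hz₀ := hz₀mesh,
      hz₀c := hz₀c,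
      hbulk := fun w h1 h2 h3 => hshδ.1 w ⟨h1, h2, h3⟩,
      hshadow := fun z z' hz hz' γ hγ => hshδ.2 z z' hz hz' γ fun t => ⟨(hγ t).1, (hγ t).2.1, (hγ t).2.2⟩,
      hc := hc, hcC := hcC, hδC := hδC, hκstep := hκstep,
      hstep := fun x hx h1 h2 h3 => hstepδ x hx ⟨h1, h2, h3⟩,
      hθ₀ := hθ₀, hθ₀π := hθ₀π, hθ₀sep := hθ₀sep, hη := hη, hδη := hδη, hsep := hsep }
  obtain ⟨d₀, n, h⟩ := X.exists_isWindowRect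
  exact ⟨X.E, d₀, n, h⟩

end Summit.CriticalPhenomena.SAWScalingLimit.Theorems.IsingBoundaryRatio

end
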